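import Summits.NavierStokesRegularity.OSWSelfSimilar.SheetRLinearisedCutoffEstimates
import HarnessLib

/-!
# SHEET-ℝ frame, linearised operator: weak solutions in the energy class are UNIQUE (energy identity with cutoffs)

HONEST FRAMING (cell ns-blowup GROUP B / zone Z3, cases Z3-SR-CERT (MODEL ASSEMBLY: «the» inverse `S = B_λ⁻¹ : L²_w → E`) and
Z3-SR-SPEC ((P1): the resolvent `R(σ)` as a genuine, single-valued operator); 1-D MODEL certificate frame (viscous gCLM/OSW sheet on the
line); not Euler/NS; «violates: none — MODEL»). Nothing here asserts that a profile exists.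

THE STATEMENT (`eq_zero_of_weak_eq_zero`).  Let `L > 0`; drift `d` and potential `V` a.e.-strongly measurable with `|d(ξ)| ≤ D₀ + D₁|ξ|`,
`|V| ≤ V₀` (the sheet's `B_λ = −∂² + (½ξ + a𝒰̄)∂ + (1 − HΩ̄ + λχ)` is in the class: `𝒰̄`, `HΩ̄`, `χ` are bounded); suppose the weak form
`linForm L d V` is `κ`-COERCIVE ON COMPACTLY SUPPORTED TESTS, `κ(‖v₁‖²_w + ¼‖v‖²_w) ≤ linForm(v; v)` for every `IsCompactTest v v₁`
(`κ > 0` — for the sheet this is EXACTLY the certificate's hypothesis (C1), whose content is interval arithmetic and is not re-proved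
here).  If `u` in the odd energy class (`u = u(0) + ∫₀u₁`, odd, `∫wu² < ∞`, `∫wu₁² < ∞`) satisfies `linForm(u; φ) = 0` for every
compactly supported test, then `u ≡ 0`; `weak_solution_unique`: two weak solutions with the same right-hand side coincide.

THE PROOF (Gaffney-type cutoff argument, no mollifier because the test class is the compactly supported ENERGY class, so `χ_R²u` is
itself a test): `0 = linForm(u; χ_R²u) = linForm(χ_Ru; χ_Ru) − ∫corr` (`SheetRLinearisedCutoffEstimates.integrand_cutoff_identity`),
coercivity on the test `χ_Ru` and `χ_R = 1` on `ξ² < R²` give `(κ/4)∫_{ξ²<R²} wu² ≤ ∫corr ≤ C∫_{R²≤ξ²} wu²` (`cutoff_energy_le`); the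
tail tends to `0` (`tendsto_tail`), so `∫wu² = 0` and `u ≡ 0` by continuity.  This is the hypothesis `happrox`-free, function-language
form of `Literature.Analysis.OperatorTheory.eq_of_approx` for the sheet; with `exists_solutionOperator_of_coercive` it makes the bounded
solution operator of the linearised sheet operator UNIQUE among energy-class weak solutions (the MODEL ASSEMBLY's packaging of `E` as a
Hilbert space is the remaining step).  Pure calculus; no definition, no named fact. WHAT THIS IS NOT: not NS; no number of record moves.
-/

noncomputable section

namespace Summit.NavierStokesRegularity.OSWSelfSimilar
namespace SheetRLinearisedUniqueness

open _root_.MeasureTheory _root_.Set _root_.Filter _root_.Real SheetRWeakProfilePV SheetRWeakToStrong SheetREnergyClass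
  SheetRLinearisedTests SheetRLinearisedCutoffEstimates
open scoped Topology

/-! ### §3 Uniqueness of weak solutions in the energy class -/

/-- The tail `∫_{R² ≤ ξ²} w u²` of the weighted mass tends to zero along `R = n + 1`. [folklore] -/
theorem tendsto_tail {L : ℝ} {u : ℝ → ℝ} (h0 : Integrable fun y => (L ^ 2 + y ^ 2) * u y ^ 2) :
    Tendsto (fun n : ℕ => ∫ ξ in {ξ : ℝ | ((n : ℝ) + 1) ^ 2 ≤ ξ ^ 2}, (L ^ 2 + ξ ^ 2) * u ξ ^ 2) atTop (𝓝 0) := by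
  have hsm : ∀ n : ℕ, MeasurableSet {ξ : ℝ | ((n : ℝ) + 1) ^ 2 ≤ ξ ^ 2} := fun n =>
    measurableSet_le measurable_const (by fun_prop)
  have hanti : Antitone (fun n : ℕ => {ξ : ℝ | ((n : ℝ) + 1) ^ 2 ≤ ξ ^ 2}) := by
    intro m n hmn ξ hξ
    simp only [mem_setOf_eq] at hξ ⊢
    have hmn' : (m : ℝ) + 1 ≤ (n : ℝ) + 1 := by exact_mod_cast Nat.succ_le_succ hmn
    have : ((m : ℝ) + 1) ^ 2 ≤ ((n : ℝ) + 1) ^ 2 := pow_le_pow_left₀ (by positivity) hmn' 2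
    linarith
  have h := tendsto_setIntegral_of_antitone hsm hanti ⟨0, h0.integrableOn⟩
  have hempty : (⋂ n : ℕ, {ξ : ℝ | ((n : ℝ) + 1) ^ 2 ≤ ξ ^ 2}) = ∅ := by
    ext ξ
    simp only [mem_iInter, mem_setOf_eq, mem_empty_iff_false, iff_false, not_forall, not_le]
    obtain ⟨n, hn⟩ := exists_nat_gt |ξ|
    refine ⟨n, ?_⟩
    have h1 : |ξ| < (n : ℝ) + 1 := by linarith
    have h2 : |ξ| ^ 2 < ((n : ℝ) + 1) ^ 2 := pow_lt_pow_left₀ h1 (abs_nonneg _) two_ne_zero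
    rwa [sq_abs] at h2
  rwa [hempty, Measure.restrict_empty, integral_zero_measure] at h

/-- **The cutoff energy inequality.** For `u` in the odd energy class solving the homogeneous weak equation against every compactly
supported test, and a form that is `κ`-coercive on compactly supported tests: for every `R ≥ 1`,
`(κ/4)·∫_{ξ² < R²} w u² ≤ C·∫_{R² ≤ ξ²} w u²` with `C = M² + 4M/L² + M(D₀ + 2D₁)` — test the equation with `χ_R²u`, apply coercivity
to `χ_R u`, and use the pointwise cutoff identity. [folklore] -/
theorem cutoff_energy_le {L D₀ D₁ V₀ κ : ℝ} {d V u u₁ : ℝ → ℝ} (hL : 0 < L) (hdm : AEStronglyMeasurable d volume)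
    (hVm : AEStronglyMeasurable V volume) (hD₀ : 0 ≤ D₀) (hD₁ : 0 ≤ D₁) (hd : ∀ ξ, |d ξ| ≤ D₀ + D₁ * |ξ|)
    (hV : ∀ ξ, |V ξ| ≤ V₀) (hκ : 0 < κ)
    (hcoer : ∀ v v₁ : ℝ → ℝ, IsCompactTest v v₁ →
      κ * ((∫ ξ, (L ^ 2 + ξ ^ 2) * v₁ ξ ^ 2) + 1 / 4 * ∫ ξ, (L ^ 2 + ξ ^ 2) * v ξ ^ 2) ≤ linForm L d V v v₁ v v₁)
    (hu : ∀ x, u x = u 0 + ∫ s in (0 : ℝ)..x, u₁ s) (hodd : ∀ y, u (-y) = -u y) (hu₁m : AEStronglyMeasurable u₁ volume)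
    (h0 : Integrable fun y => (L ^ 2 + y ^ 2) * u y ^ 2) (h1 : Integrable fun y => (L ^ 2 + y ^ 2) * u₁ y ^ 2)
    (hweak : ∀ φ φ₁ : ℝ → ℝ, IsCompactTest φ φ₁ → linForm L d V u u₁ φ φ₁ = 0)
    {M : ℝ} (hM0 : 0 ≤ M) (hM : ∀ R : ℝ, 0 < R → ∀ ξ : ℝ, |deriv (cutoff R) ξ| ≤ M / R) {R : ℝ} (hR : 1 ≤ R) :
    κ / 4 * ∫ ξ in {ξ : ℝ | R ^ 2 ≤ ξ ^ 2}ᶜ, (L ^ 2 + ξ ^ 2) * u ξ ^ 2 ≤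
      (M ^ 2 + 4 * M / L ^ 2 + M * (D₀ + 2 * D₁)) * ∫ ξ in {ξ : ℝ | R ^ 2 ≤ ξ ^ 2}, (L ^ 2 + ξ ^ 2) * u ξ ^ 2 := by
  have hR0 : 0 < R := by linarith
  obtain ⟨huc, hu₁2, hu2, -, -⟩ := basic_of_primitive hL hu hu₁m h0 h1
  have hMR := hM R hR0
  set χ : ℝ → ℝ := cutoff R with hχ
  set χ' : ℝ → ℝ := deriv (cutoff R) with hχ'
  have hw : ∀ ξ : ℝ, 0 < L ^ 2 + ξ ^ 2 := fun ξ => by positivity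
  have hmeas : MeasurableSet {ξ : ℝ | R ^ 2 ≤ ξ ^ 2} := measurableSet_le measurable_const (by fun_prop)
  -- the two tests
  obtain ⟨htest, -⟩ := isCompactTest_cutoff_mul hR0 hu hodd hu₁2 hu2
  have htest2 := isCompactTest_cutoff_sq_mul hR0 hu hodd hu₁2 hu2
  have hw0 := hweak _ _ htest2
  have hco := hcoer _ _ htest
  -- the identity `linForm(u; χ²u) = linForm(χu; χu) − ∫ corr`
  have hdiag := integrable_diag hL hdm hVm hD₀ hD₁ hd hV hu hu₁m h0 h1 hR hM0 hMR
  obtain ⟨-, hcorr_int, hcorr_le⟩ := corr_le hL hdm hD₀ hD₁ hd hu hu₁m h0 h1 hR hM0 hMR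
  have hident : linForm L d V u u₁ (fun ξ => χ ξ * (χ ξ * u ξ))
      (fun ξ => χ' ξ * (χ ξ * u ξ) + χ ξ * (χ' ξ * u ξ + χ ξ * u₁ ξ)) =
      linForm L d V (fun ξ => χ ξ * u ξ) (fun ξ => χ' ξ * u ξ + χ ξ * u₁ ξ) (fun ξ => χ ξ * u ξ)
        (fun ξ => χ' ξ * u ξ + χ ξ * u₁ ξ) -
      ∫ ξ, ((L ^ 2 + ξ ^ 2) * χ' ξ ^ 2 + 2 * ξ * (χ ξ * χ' ξ) + (L ^ 2 + ξ ^ 2) * d ξ * (χ ξ * χ' ξ)) * u ξ ^ 2 := by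
    simp only [linForm]
    rw [← integral_sub hdiag hcorr_int]
    refine integral_congr_ae (Eventually.of_forall fun ξ => ?_)
    exact integrand_cutoff_identity L d V u u₁ χ χ' ξ
  -- hence `linForm(χu; χu) = ∫ corr ≤ C · tail`
  have hvv : linForm L d V (fun ξ => χ ξ * u ξ) (fun ξ => χ' ξ * u ξ + χ ξ * u₁ ξ) (fun ξ => χ ξ * u ξ)
      (fun ξ => χ' ξ * u ξ + χ ξ * u₁ ξ) ≤
      (M ^ 2 + 4 * M / L ^ 2 + M * (D₀ + 2 * D₁)) * ∫ ξ in {ξ : ℝ | R ^ 2 ≤ ξ ^ 2}, (L ^ 2 + ξ ^ 2) * u ξ ^ 2 := by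
    rw [hw0] at hident
    linarith
  -- lower bound: `∫_{ξ² < R²} w u² ≤ ∫ w (χu)²`
  have hχsq : Integrable fun ξ => (L ^ 2 + ξ ^ 2) * (χ ξ * u ξ) ^ 2 := by
    refine h0.mono' ((by fun_prop : AEStronglyMeasurable (fun ξ : ℝ => L ^ 2 + ξ ^ 2) volume).mul
      (((contDiff_cutoff R).continuous.mul huc).pow 2).aestronglyMeasurable) (Eventually.of_forall fun ξ => ?_)
    rw [Real.norm_eq_abs, abs_of_nonneg (by positivity), mul_pow]
    obtain ⟨h0', h1'⟩ := cutoff_nonneg_le_one R ξ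
    have : χ ξ ^ 2 ≤ 1 := by nlinarith
    nlinarith [mul_nonneg (hw ξ).le (sq_nonneg (u ξ))]
  have hlow : ∫ ξ in {ξ : ℝ | R ^ 2 ≤ ξ ^ 2}ᶜ, (L ^ 2 + ξ ^ 2) * u ξ ^ 2 ≤ ∫ ξ, (L ^ 2 + ξ ^ 2) * (χ ξ * u ξ) ^ 2 := by
    rw [← integral_indicator hmeas.compl]
    refine integral_mono (h0.indicator hmeas.compl) hχsq fun ξ => ?_
    by_cases hξ : ξ ∈ {ξ : ℝ | R ^ 2 ≤ ξ ^ 2}ᶜ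
    · rw [indicator_of_mem hξ]
      simp only [mem_compl_iff, mem_setOf_eq, not_le] at hξ
      have hχ1 : χ ξ = 1 := cutoff_eq_one hR0 hξ.le
      rw [hχ1, one_mul]
    · rw [indicator_of_notMem hξ]
      positivity
  have hv₁nn : 0 ≤ ∫ ξ, (L ^ 2 + ξ ^ 2) * (χ' ξ * u ξ + χ ξ * u₁ ξ) ^ 2 := integral_nonneg fun ξ => by positivity
  calc κ / 4 * ∫ ξ in {ξ : ℝ | R ^ 2 ≤ ξ ^ 2}ᶜ, (L ^ 2 + ξ ^ 2) * u ξ ^ 2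
      ≤ κ / 4 * ∫ ξ, (L ^ 2 + ξ ^ 2) * (χ ξ * u ξ) ^ 2 := mul_le_mul_of_nonneg_left hlow (by positivity)
    _ ≤ κ * ((∫ ξ, (L ^ 2 + ξ ^ 2) * (χ' ξ * u ξ + χ ξ * u₁ ξ) ^ 2) + 1 / 4 * ∫ ξ, (L ^ 2 + ξ ^ 2) * (χ ξ * u ξ) ^ 2) := by
        nlinarith [mul_nonneg hκ.le hv₁nn]
    _ ≤ _ := hco
    _ ≤ _ := hvv

/-- **Uniqueness of weak solutions in the energy class.** Let `L > 0`, `d, V` a.e.-strongly measurable with `|d(ξ)| ≤ D₀ + D₁|ξ|`,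
`|V| ≤ V₀`, and suppose the weak form `linForm L d V` is `κ`-COERCIVE ON COMPACTLY SUPPORTED TESTS:
`κ(‖v₁‖²_w + ¼‖v‖²_w) ≤ linForm(v; v)` for every `IsCompactTest v v₁` (`κ > 0`; for the sheet this is the certificate's (C1)).  If `u` in
the odd energy class (`u = u(0) + ∫₀u₁`, `u` odd, `∫wu² < ∞`, `∫wu₁² < ∞`) satisfies `linForm(u; φ) = 0` for every compactly supported
test `(φ, φ₁)`, then `u ≡ 0`.  (So weak solutions of `(−∂² + d∂ + V)u = g` in the energy class are unique; the solution operator of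
`Literature.Analysis.OperatorTheory.exists_solutionOperator_of_coercive` is «the» inverse.) [folklore] -/
theorem eq_zero_of_weak_eq_zero {L D₀ D₁ V₀ κ : ℝ} {d V u u₁ : ℝ → ℝ} (hL : 0 < L) (hdm : AEStronglyMeasurable d volume)
    (hVm : AEStronglyMeasurable V volume) (hD₀ : 0 ≤ D₀) (hD₁ : 0 ≤ D₁) (hd : ∀ ξ, |d ξ| ≤ D₀ + D₁ * |ξ|)
    (hV : ∀ ξ, |V ξ| ≤ V₀) (hκ : 0 < κ)
    (hcoer : ∀ v v₁ : ℝ → ℝ, IsCompactTest v v₁ →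
      κ * ((∫ ξ, (L ^ 2 + ξ ^ 2) * v₁ ξ ^ 2) + 1 / 4 * ∫ ξ, (L ^ 2 + ξ ^ 2) * v ξ ^ 2) ≤ linForm L d V v v₁ v v₁)
    (hu : ∀ x, u x = u 0 + ∫ s in (0 : ℝ)..x, u₁ s) (hodd : ∀ y, u (-y) = -u y) (hu₁m : AEStronglyMeasurable u₁ volume)
    (h0 : Integrable fun y => (L ^ 2 + y ^ 2) * u y ^ 2) (h1 : Integrable fun y => (L ^ 2 + y ^ 2) * u₁ y ^ 2)
    (hweak : ∀ φ φ₁ : ℝ → ℝ, IsCompactTest φ φ₁ → linForm L d V u u₁ φ φ₁ = 0) : ∀ x, u x = 0 := by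
  obtain ⟨huc, -, -, -, -⟩ := basic_of_primitive hL hu hu₁m h0 h1
  obtain ⟨M, hM0, hM⟩ := exists_deriv_cutoff_le
  set C : ℝ := M ^ 2 + 4 * M / L ^ 2 + M * (D₀ + 2 * D₁) with hC
  set I : ℝ := ∫ ξ, (L ^ 2 + ξ ^ 2) * u ξ ^ 2 with hI
  set T : ℕ → ℝ := fun n => ∫ ξ in {ξ : ℝ | ((n : ℝ) + 1) ^ 2 ≤ ξ ^ 2}, (L ^ 2 + ξ ^ 2) * u ξ ^ 2 with hT
  have hstep : ∀ n : ℕ, κ / 4 * I ≤ (κ / 4 + C) * T n := by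
    intro n
    have hR : (1 : ℝ) ≤ (n : ℝ) + 1 := by
      have : (0 : ℝ) ≤ n := Nat.cast_nonneg n
      linarith
    have hmeas : MeasurableSet {ξ : ℝ | ((n : ℝ) + 1) ^ 2 ≤ ξ ^ 2} := measurableSet_le measurable_const (by fun_prop)
    have hsplit := integral_add_compl hmeas h0
    have h := cutoff_energy_le hL hdm hVm hD₀ hD₁ hd hV hκ hcoer hu hodd hu₁m h0 h1 hweak hM0 hM hR
    have hTI : ∫ ξ in {ξ : ℝ | ((n : ℝ) + 1) ^ 2 ≤ ξ ^ 2}ᶜ, (L ^ 2 + ξ ^ 2) * u ξ ^ 2 = I - T n := by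
      rw [hI, hT, ← hsplit]
      ring
    rw [hTI] at h
    have : κ / 4 * I ≤ κ / 4 * T n + C * T n := by linarith
    linarith
  have hlim : Tendsto (fun n : ℕ => (κ / 4 + C) * T n) atTop (𝓝 0) := by
    have := (tendsto_tail h0).const_mul (κ / 4 + C)
    rwa [mul_zero] at this
  have hI0 : κ / 4 * I ≤ 0 := ge_of_tendsto' hlim hstep
  have hInn : 0 ≤ I := integral_nonneg fun ξ => by positivity
  have hIz : I = 0 := by nlinarith
  -- `∫ w u² = 0` with a continuous nonnegative integrand forces `u ≡ 0`
  have hae : (fun ξ => (L ^ 2 + ξ ^ 2) * u ξ ^ 2) =ᵐ[volume] 0 :=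
    (integral_eq_zero_iff_of_nonneg (fun ξ => by positivity) h0).1 hIz
  have hcont : Continuous fun ξ : ℝ => (L ^ 2 + ξ ^ 2) * u ξ ^ 2 := by fun_prop
  have hzero : (fun ξ => (L ^ 2 + ξ ^ 2) * u ξ ^ 2) = 0 := (hcont.ae_eq_iff_eq volume continuous_const).1 hae
  intro x
  have hx := congrFun hzero x
  simp only [Pi.zero_apply, mul_eq_zero] at hx
  rcases hx with hx | hx
  · exact absurd hx (by positivity)
  · exact pow_eq_zero_iff two_ne_zero |>.1 hx

/-- **Two weak solutions with the same datum coincide** (linearity of `linForm` in the profile slot). [folklore] -/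
theorem weak_solution_unique {L D₀ D₁ V₀ κ : ℝ} {d V u u₁ u' u₁' : ℝ → ℝ} {rhs : (ℝ → ℝ) → (ℝ → ℝ) → ℝ} (hL : 0 < L)
    (hdm : AEStronglyMeasurable d volume) (hVm : AEStronglyMeasurable V volume) (hD₀ : 0 ≤ D₀) (hD₁ : 0 ≤ D₁)
    (hd : ∀ ξ, |d ξ| ≤ D₀ + D₁ * |ξ|) (hV : ∀ ξ, |V ξ| ≤ V₀) (hκ : 0 < κ)
    (hcoer : ∀ v v₁ : ℝ → ℝ, IsCompactTest v v₁ →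
      κ * ((∫ ξ, (L ^ 2 + ξ ^ 2) * v₁ ξ ^ 2) + 1 / 4 * ∫ ξ, (L ^ 2 + ξ ^ 2) * v ξ ^ 2) ≤ linForm L d V v v₁ v v₁)
    (hu : ∀ x, u x = u 0 + ∫ s in (0 : ℝ)..x, u₁ s) (hodd : ∀ y, u (-y) = -u y) (hu₁m : AEStronglyMeasurable u₁ volume)
    (h0 : Integrable fun y => (L ^ 2 + y ^ 2) * u y ^ 2) (h1 : Integrable fun y => (L ^ 2 + y ^ 2) * u₁ y ^ 2)
    (hu' : ∀ x, u' x = u' 0 + ∫ s in (0 : ℝ)..x, u₁' s) (hodd' : ∀ y, u' (-y) = -u' y) (hu₁m' : AEStronglyMeasurable u₁' volume)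
    (h0' : Integrable fun y => (L ^ 2 + y ^ 2) * u' y ^ 2) (h1' : Integrable fun y => (L ^ 2 + y ^ 2) * u₁' y ^ 2)
    (hsol : ∀ φ φ₁ : ℝ → ℝ, IsCompactTest φ φ₁ → linForm L d V u u₁ φ φ₁ = rhs φ φ₁)
    (hsol' : ∀ φ φ₁ : ℝ → ℝ, IsCompactTest φ φ₁ → linForm L d V u' u₁' φ φ₁ = rhs φ φ₁)
    (hlin : ∀ φ φ₁ : ℝ → ℝ, IsCompactTest φ φ₁ → linForm L d V (fun ξ => u ξ - u' ξ) (fun ξ => u₁ ξ - u₁' ξ) φ φ₁ =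
      linForm L d V u u₁ φ φ₁ - linForm L d V u' u₁' φ φ₁) : ∀ x, u x = u' x := by
  have hdiff : ∀ x, u x - u' x = (u 0 - u' 0) + ∫ s in (0 : ℝ)..x, (u₁ s - u₁' s) := by
    intro x
    have hii := intervalIntegrable_of_memLp_two (memLp_two_of_weighted_sq hL hu₁m h1)
    have hii' := intervalIntegrable_of_memLp_two (memLp_two_of_weighted_sq hL hu₁m' h1')
    rw [intervalIntegral.integral_sub (hii 0 x) (hii' 0 x), hu x, hu' x]
    ring
  have hw2 : ∀ (f g : ℝ → ℝ), Integrable (fun y => (L ^ 2 + y ^ 2) * f y ^ 2) → Integrable (fun y => (L ^ 2 + y ^ 2) * g y ^ 2) →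
      AEStronglyMeasurable f volume → AEStronglyMeasurable g volume →
      Integrable (fun y => (L ^ 2 + y ^ 2) * (f y - g y) ^ 2) := by
    intro f g hf hg hfm hgm
    refine ((hf.add hg).const_mul 2).mono' ((by fun_prop : AEStronglyMeasurable (fun y : ℝ => L ^ 2 + y ^ 2) volume).mul
      ((hfm.sub hgm).pow 2)) (Eventually.of_forall fun y => ?_)
    rw [Real.norm_eq_abs, abs_of_nonneg (by positivity)]
    simp only [Pi.add_apply]
    have hw : 0 ≤ L ^ 2 + y ^ 2 := by positivity
    nlinarith [mul_nonneg hw (sq_nonneg (f y + g y))]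
  obtain ⟨huc, -, -, -, -⟩ := basic_of_primitive hL hu hu₁m h0 h1
  obtain ⟨huc', -, -, -, -⟩ := basic_of_primitive hL hu' hu₁m' h0' h1'
  have hz := eq_zero_of_weak_eq_zero (u := fun ξ => u ξ - u' ξ) (u₁ := fun ξ => u₁ ξ - u₁' ξ) hL hdm hVm hD₀ hD₁ hd hV hκ hcoer
    hdiff (fun y => by simp only [hodd, hodd']; ring) (hu₁m.sub hu₁m')
    (hw2 u u' h0 h0' huc.aestronglyMeasurable huc'.aestronglyMeasurable) (hw2 u₁ u₁' h1 h1' hu₁m hu₁m')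
    (fun φ φ₁ hφ => by rw [hlin φ φ₁ hφ, hsol φ φ₁ hφ, hsol' φ φ₁ hφ, sub_self])
  intro x
  have := hz x
  linarith


end SheetRLinearisedUniqueness
end Summit.NavierStokesRegularity.OSWSelfSimilar

end
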